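import Literature.Analysis.FluidPDE.NSStrongSolutions2D
import Summits.AnomalousDissipation.AnomalousDissipation.Theorems.BaireTransferDenseLoudDesignerForcesErgodicLine

/-!
# Stub 3b `stub_trajectoryPowerBudget` of the line `ergodic-budget-selection-closing`
# (crux `BaireTransfer.DenseLoudDesignerForces`, stmt-AnomalousDissipation-1143)

Sorry-free discharge of the registered stub `stub_trajectoryPowerBudget` of the lead's skeleton
(`Cruxes/DenseLoudDesignerForces/Lines/ergodic-budget-selection-closing.lean`) over the landed line vocabulary
`Theorems/BaireTransferDenseLoudDesignerForcesErgodicLine.lean` (namespace `…Theorems.DenseLoudDesignerForces.Ergodic`: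
`Hsp`, `rep`, `enstrophyObs`, `energyAvg`, `dissipAvg`, `IsNSPhase`).

**Statement (the trajectory POWER BUDGET).**  Let `(K, φ)` be an NS phase for the steady force `F` at viscosity
`ν` and `x ∈ K`.  If the trajectory time means of the energy `T⁻¹ ∫₀ᵀ ‖φ_t x‖² dt → e` and of the dissipation
`T⁻¹ ∫₀ᵀ ν‖∇φ_t x‖² dt → δ` as `T → ∞`, then `δ ≤ ‖F‖_{L²} √e`: dissipation costs force × √energy
(Doering–Foias 2002, §2, the first step of every dissipation-rate bound).

**Proof.**  Along the classical trajectory `(u, p)` of `x` (`IsNSPhase.trajectory`: a global classical solution on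
`[0, ∞) × T³` with `u(t)` representing `φ_t x`) one has `‖φ_t x‖² = ∫ ‖u(t)‖²` (the `L²` norm of a class is the
integral of any representative) and `enstrophyObs (φ_t x) = ‖∇u(t)‖₂²` (the spectral enstrophy only sees the
a.e.-class, `eGradNormSq_congr_ae`, and agrees with the classical one on smooth slices,
`Torus.gradNormSq_eq_toReal_eGradNormSq_holds`).  The energy EQUALITY of classical solutions
(`Torus.IsClassicalNSSolutionOn.energy_eq`, Robinson–Rodrigo–Sadowski 2016 Thm. 6.5) gives
`ν∫₀ᵀ‖∇u‖² ≤ ½‖u(0)‖² + ∫₀ᵀ∫⟪F, u⟫`, and the weighted AM–GM inequality in space-time bounds the injected power,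
`2∫₀ᵀ∫⟪F, u⟫ ≤ λ T ∫‖F‖² + λ⁻¹ ∫₀ᵀ∫‖u‖²` for every `λ > 0`.  Dividing by `T` and letting `T → ∞`:
`2δ ≤ λ‖F‖₂² + e/λ` for all `λ > 0`, whence `δ² ≤ ‖F‖₂² e` (optimise in `λ`), i.e. `δ ≤ ‖F‖₂ √e`.  The sign of `ν`
plays no role.

References: C. R. Doering, C. Foias, *Energy dissipation in body-forced turbulence*, J. Fluid Mech. 467 (2002) §2;
J. C. Robinson, J. L. Rodrigo, W. Sadowski, *The Three-Dimensional Navier–Stokes Equations* (CUP 2016) Thm. 6.5;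
Foias–Manley–Rosa–Temam, *Navier–Stokes Equations and Turbulence* (CUP 2001) Ch. IV §2, Ch. V §1.
-/

set_option linter.dupNamespace false

noncomputable section

open scoped BigOperators Topology ENNReal InnerProductSpace
open Filter Set Function MeasureTheory

namespace Summit.AnomalousDissipation.AnomalousDissipation.Theorems.DenseLoudDesignerForces.Ergodic

open Literature.Analysis.FunctionSpaces Literature.Analysis.FunctionSpaces.Torus
open Literature.Analysis.FluidPDE Literature.Analysis.FluidPDE.Torus
open Summit.AnomalousDissipation.AnomalousDissipation.Theses.BaireTransfer
open Summit.AnomalousDissipation.AnomalousDissipation.Theorems.DenseLoudDesignerForces.Negative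

/-! ## The power budget along one trajectory (stub 3b of the line)

Energy equality of the classical trajectory + Cauchy–Schwarz (as weighted AM–GM) in space and time, then
`T → ∞` along the converging time means. -/

section TrajectoryPowerBudget

variable {ν : ℝ} {F : (UnitAddTorus (Fin 3)) → (EuclideanSpace ℝ (Fin 3))}
  {u : ℝ → (UnitAddTorus (Fin 3)) → (EuclideanSpace ℝ (Fin 3))} {p : ℝ → (UnitAddTorus (Fin 3)) → ℝ}

/-- The squared `H`-norm of a state is the integral of the squared norm of any representative:
`‖v‖² = ∫ ‖w‖²` whenever `rep v = w` a.e. (Mathlib's `L²` inner product read on the diagonal). [folklore] -/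
theorem stub_trajectoryPowerBudget_aux_norm_sq (v : Hsp) {w : (UnitAddTorus (Fin 3)) → (EuclideanSpace ℝ (Fin 3))}
    (h : rep v =ᵐ[volume] w) : ‖v‖ ^ 2 = ∫ y, ‖w y‖ ^ 2 := by
  have h1 : ‖v‖ = ‖(v : Lp (EuclideanSpace ℝ (Fin 3)) 2 (volume : Measure (UnitAddTorus (Fin 3))))‖ := rfl
  rw [h1, ← real_inner_self_eq_norm_sq, MeasureTheory.L2.inner_def]
  refine integral_congr_ae (h.mono fun y hy => ?_)
  show ⟪rep v y, rep v y⟫_ℝ = ‖w y‖ ^ 2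
  rw [hy, real_inner_self_eq_norm_sq]

/-- The enstrophy observable of a state with a SMOOTH representative `w` is the classical `‖∇w‖₂²`
(the spectral `eGradNormSq` only sees the a.e.-class and agrees with `gradNormSq` on smooth fields). [folklore] -/
theorem stub_trajectoryPowerBudget_aux_enstrophyObs_eq (v : Hsp)
    {w : (UnitAddTorus (Fin 3)) → (EuclideanSpace ℝ (Fin 3))} (hw : IsSmooth w) (h : rep v =ᵐ[volume] w) :
    enstrophyObs v = gradNormSq w := by
  unfold enstrophyObs
  rw [Literature.Analysis.FluidPDE.eGradNormSq_congr_ae h, gradNormSq_eq_toReal_eGradNormSq_holds hw]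

/-- The steady force of a classical solution on `[0, ∞)` is smooth: it is `∂ₜu + (u·∇)u − νΔu + ∇p` at time
`0` by the momentum equation. [folklore] -/
theorem stub_trajectoryPowerBudget_aux_isSmooth_force (h : IsClassicalNSSolutionOn (Ici 0) ν (fun _ => F) u p) :
    IsSmooth F := by
  have hU : UniqueDiffOn ℝ (Ici (0 : ℝ)) := uniqueDiffOn_Ici 0
  have h0 : (0 : ℝ) ∈ Ici (0 : ℝ) := mem_Ici.2 le_rfl
  have hu := h.smooth_velocity
  have hut : IsSmooth (u 0) := hu.isSmooth_slice h0
  have hpt : IsSmooth (p 0) := h.smooth_pressure.isSmooth_slice h0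
  have hsm : IsSmooth (fun y => Torus.timeDerivWithin (Ici 0) u 0 y + convect (u 0) (u 0) y -
      ν • laplacian (u 0) y + Torus.gradient (p 0) y) :=
    (((hu.isSmooth_timeDerivWithin hU h0).add (hut.convect hut)).sub (hut.laplacian.smul ν)).add
      hpt.gradient
  have hFeq : F = fun y => Torus.timeDerivWithin (Ici 0) u 0 y + convect (u 0) (u 0) y -
      ν • laplacian (u 0) y + Torus.gradient (p 0) y := by
    funext y
    have hm := h.momentum 0 h0 y
    calc F y = (ν • laplacian (u 0) y - Torus.gradient (p 0) y + F y) -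
        ν • laplacian (u 0) y + Torus.gradient (p 0) y := by abel
      _ = _ := by rw [← hm]
  rw [hFeq]
  exact hsm

/-- INJECTED POWER BOUND (weighted AM–GM in space-time): for `u` jointly smooth on `[0, ∞) × T³`, `F` smooth,
`T ≥ 0` and `λ > 0`, `2 ∫₀ᵀ ∫ ⟪F, u⟫ ≤ λ · T ∫‖F‖² + λ⁻¹ ∫₀ᵀ ∫ ‖u‖²`. [folklore] -/
theorem stub_trajectoryPowerBudget_aux_power_le (hu : IsSmoothSpaceTimeOn (Ici 0) u) (hF : IsSmooth F)
    {T : ℝ} (hT : 0 ≤ T) {lam : ℝ} (hlam : 0 < lam) :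
    2 * ∫ t in (0 : ℝ)..T, ∫ y, ⟪F y, u t y⟫_ℝ ≤
      lam * (T * ∫ y, ‖F y‖ ^ 2) + (∫ t in (0 : ℝ)..T, ∫ y, ‖u t y‖ ^ 2) / lam := by
  set A : ℝ := ∫ y, ‖F y‖ ^ 2 with hAdef
  have he_st : IsSmoothSpaceTimeOn (Ici 0) (fun r y => ‖u r y‖ ^ 2) := hu.normSq
  have he_cont : ContinuousOn (fun r => ∫ y, ‖u r y‖ ^ 2) (Ici 0) :=
    he_st.continuousOn_integral (convex_Ici 0)
  have hP_cont : ContinuousOn (fun r => ∫ y, ⟪F y, u r y⟫_ℝ) (Ici 0) :=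
    ((isSmoothSpaceTimeOn_const hF _).inner hu).continuousOn_integral (convex_Ici 0)
  have hsub : uIcc 0 T ⊆ Ici 0 := by
    rw [uIcc_of_le hT]
    exact Icc_subset_Ici_self
  -- pointwise AM–GM, integrated in space
  have hspace : ∀ r ∈ Ici (0 : ℝ), 2 * ∫ y, ⟪F y, u r y⟫_ℝ ≤ lam * A + (∫ y, ‖u r y‖ ^ 2) / lam := by
    intro r hr
    have hur : IsSmooth (u r) := hu.isSmooth_slice hr
    have hint1 : Integrable (fun y => ⟪F y, u r y⟫_ℝ) := (hF.inner hur).integrable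
    have hint2 : Integrable (fun y => lam * ‖F y‖ ^ 2 + ‖u r y‖ ^ 2 / lam) :=
      ((hF.norm_sq.integrable).const_mul lam).add (hur.norm_sq.integrable.div_const lam)
    have hpt : ∀ y, 2 * ⟪F y, u r y⟫_ℝ ≤ lam * ‖F y‖ ^ 2 + ‖u r y‖ ^ 2 / lam := fun y =>
      (mul_le_mul_of_nonneg_left (real_inner_le_norm _ _) zero_le_two).trans (two_mul_le_weighted hlam)
    calc 2 * ∫ y, ⟪F y, u r y⟫_ℝ = ∫ y, 2 * ⟪F y, u r y⟫_ℝ := (integral_const_mul _ _).symm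
      _ ≤ ∫ y, (lam * ‖F y‖ ^ 2 + ‖u r y‖ ^ 2 / lam) := integral_mono (hint1.const_mul 2) hint2 hpt
      _ = lam * A + (∫ y, ‖u r y‖ ^ 2) / lam := by
          rw [integral_add ((hF.norm_sq.integrable).const_mul lam) (hur.norm_sq.integrable.div_const lam),
            integral_const_mul, integral_div]
  -- integrate in time over `[0, T]`
  have hi1 : IntervalIntegrable (fun r => ∫ y, ⟪F y, u r y⟫_ℝ) volume 0 T :=
    (hP_cont.mono hsub).intervalIntegrable
  have hiE : IntervalIntegrable (fun r => ∫ y, ‖u r y‖ ^ 2) volume 0 T :=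
    (he_cont.mono hsub).intervalIntegrable
  have hi2 : IntervalIntegrable (fun r => lam * A + (∫ y, ‖u r y‖ ^ 2) / lam) volume 0 T :=
    intervalIntegrable_const.add (hiE.div_const lam)
  calc 2 * ∫ r in (0 : ℝ)..T, ∫ y, ⟪F y, u r y⟫_ℝ
      = ∫ r in (0 : ℝ)..T, 2 * ∫ y, ⟪F y, u r y⟫_ℝ := (intervalIntegral.integral_const_mul _ _).symm
    _ ≤ ∫ r in (0 : ℝ)..T, (lam * A + (∫ y, ‖u r y‖ ^ 2) / lam) :=
        intervalIntegral.integral_mono_on hT (hi1.const_mul 2) hi2 fun r hr => hspace r hr.1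
    _ = lam * (T * A) + (∫ r in (0 : ℝ)..T, ∫ y, ‖u r y‖ ^ 2) / lam := by
        rw [intervalIntegral.integral_add intervalIntegrable_const (hiE.div_const lam),
          intervalIntegral.integral_const, intervalIntegral.integral_div]
        simp only [smul_eq_mul, sub_zero]
        ring

/-- FINITE-TIME POWER BUDGET of a classical solution on `[0, ∞)` with steady force: for `T ≥ 0` and `λ > 0`,
`2ν ∫₀ᵀ ‖∇u‖₂² ≤ ‖u(0)‖₂² + λ · T ∫‖F‖² + λ⁻¹ ∫₀ᵀ ∫‖u‖²` (energy equality, `½‖u(T)‖² ≥ 0`, and the injected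
power bound). [cite: RobinsonRodrigoSadowski2016, Thm. 6.5] -/
theorem stub_trajectoryPowerBudget_aux_budget (h : IsClassicalNSSolutionOn (Ici 0) ν (fun _ => F) u p)
    {T : ℝ} (hT : 0 ≤ T) {lam : ℝ} (hlam : 0 < lam) :
    2 * (ν * ∫ t in (0 : ℝ)..T, gradNormSq (u t)) ≤ 2 * kineticEnergy (u 0) +
      lam * (T * ∫ y, ‖F y‖ ^ 2) + (∫ t in (0 : ℝ)..T, ∫ y, ‖u t y‖ ^ 2) / lam := by
  have hE := h.energy_eq (convex_Ici 0) hT Icc_subset_Ici_self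
  have hKT : 0 ≤ kineticEnergy (u T) := Torus.kineticEnergy_nonneg _
  have hP := stub_trajectoryPowerBudget_aux_power_le h.smooth_velocity
    (stub_trajectoryPowerBudget_aux_isSmooth_force h) hT hlam
  linarith

/-- **Stub 3b of the line `ergodic-budget-selection-closing`: the trajectory power budget.**  For an NS phase
`(K, φ)` with steady force `F` and `x ∈ K`, if the time means of the energy and of the dissipation along the
trajectory of `x` converge to `e` and `δ`, then `δ ≤ ‖F‖_{L²} √e` (energy equality of the classical trajectory,
Cauchy–Schwarz in space and time, `T → ∞`). [cite: DoeringFoias2002, §2] -/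
theorem stub_trajectoryPowerBudget {ν : ℝ} {F : (UnitAddTorus (Fin 3)) → (EuclideanSpace ℝ (Fin 3))} {K : Set Hsp} {φ : ℝ → Hsp → Hsp} (hK : IsNSPhase ν F K φ) {x : Hsp} (hx : x ∈ K) {e δ : ℝ} (he : Tendsto (energyAvg φ x) atTop (𝓝 e)) (hd : Tendsto (dissipAvg ν φ x) atTop (𝓝 δ)) : δ ≤ Real.sqrt (∫ y, ‖F y‖ ^ 2) * Real.sqrt e := by
  obtain ⟨u, p, hsol, hrep⟩ := hK.trajectory x hx
  have hu := hsol.smooth_velocity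
  set A : ℝ := ∫ y, ‖F y‖ ^ 2 with hAdef
  have hA : 0 ≤ A := integral_nonneg fun _ => sq_nonneg _
  -- the limit energy is nonnegative
  have he0 : 0 ≤ e := by
    refine ge_of_tendsto he ?_
    filter_upwards [eventually_ge_atTop (0 : ℝ)] with T hT
    exact mul_nonneg (inv_nonneg.2 hT) (intervalIntegral.integral_nonneg hT fun t _ => sq_nonneg _)
  -- transfer of the observables to the classical trajectory
  have hnorm : ∀ t : ℝ, 0 ≤ t → ‖φ t x‖ ^ 2 = ∫ y, ‖u t y‖ ^ 2 := fun t ht =>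
    stub_trajectoryPowerBudget_aux_norm_sq (φ t x) (hrep t ht)
  have hens : ∀ t : ℝ, 0 ≤ t → enstrophyObs (φ t x) = gradNormSq (u t) := fun t ht =>
    stub_trajectoryPowerBudget_aux_enstrophyObs_eq (φ t x) (hu.isSmooth_slice ht) (hrep t ht)
  have henergy : ∀ T : ℝ, 0 ≤ T → energyAvg φ x T = T⁻¹ * ∫ t in (0 : ℝ)..T, ∫ y, ‖u t y‖ ^ 2 := by
    intro T hT
    unfold energyAvg
    congr 1
    refine intervalIntegral.integral_congr fun t ht => ?_
    rw [uIcc_of_le hT] at ht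
    exact hnorm t ht.1
  have hdiss : ∀ T : ℝ, 0 ≤ T →
      dissipAvg ν φ x T = T⁻¹ * (ν * ∫ t in (0 : ℝ)..T, gradNormSq (u t)) := by
    intro T hT
    have hI : ∫ t in (0 : ℝ)..T, ν * enstrophyObs (φ t x) = ∫ t in (0 : ℝ)..T, ν * gradNormSq (u t) := by
      refine intervalIntegral.integral_congr fun t ht => ?_
      rw [uIcc_of_le hT] at ht
      show ν * enstrophyObs (φ t x) = ν * gradNormSq (u t)
      rw [hens t ht.1]
    unfold dissipAvg
    rw [hI, intervalIntegral.integral_const_mul]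
  -- the budget in the limit `T → ∞`, for every weight `λ > 0`
  have hkey : ∀ lam : ℝ, 0 < lam → 2 * δ ≤ lam * A + e / lam := by
    intro lam hlam
    have hL : Tendsto (fun T : ℝ => 2 * dissipAvg ν φ x T) atTop (𝓝 (2 * δ)) := hd.const_mul 2
    have hR : Tendsto (fun T : ℝ => 2 * kineticEnergy (u 0) * T⁻¹ + lam * A + energyAvg φ x T / lam) atTop
        (𝓝 (2 * kineticEnergy (u 0) * 0 + lam * A + e / lam)) :=
      ((tendsto_inv_atTop_zero.const_mul _).add tendsto_const_nhds).add (he.div_const lam)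
    rw [mul_zero, zero_add] at hR
    refine le_of_tendsto_of_tendsto hL hR ?_
    filter_upwards [eventually_gt_atTop (0 : ℝ)] with T hT
    have hB := stub_trajectoryPowerBudget_aux_budget hsol hT.le hlam
    have hTinv : 0 ≤ T⁻¹ := inv_nonneg.2 hT.le
    calc 2 * dissipAvg ν φ x T = T⁻¹ * (2 * (ν * ∫ t in (0 : ℝ)..T, gradNormSq (u t))) := by
          rw [hdiss T hT.le]; ring
      _ ≤ T⁻¹ * (2 * kineticEnergy (u 0) + lam * (T * A) + (∫ t in (0 : ℝ)..T, ∫ y, ‖u t y‖ ^ 2) / lam) :=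
          mul_le_mul_of_nonneg_left hB hTinv
      _ = 2 * kineticEnergy (u 0) * T⁻¹ + lam * A + (T⁻¹ * ∫ t in (0 : ℝ)..T, ∫ y, ‖u t y‖ ^ 2) / lam := by
          field_simp
      _ = 2 * kineticEnergy (u 0) * T⁻¹ + lam * A + energyAvg φ x T / lam := by rw [henergy T hT.le]
  -- optimise in `λ`
  rcases le_or_gt δ 0 with hδ | hδ
  · exact hδ.trans (mul_nonneg (Real.sqrt_nonneg _) (Real.sqrt_nonneg _))
  · have hsq : δ ^ 2 ≤ A * e := sq_le_mul_of_forall_weighted hA he0 hδ.le hkey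
    calc δ = Real.sqrt (δ ^ 2) := (Real.sqrt_sq hδ.le).symm
      _ ≤ Real.sqrt (A * e) := Real.sqrt_le_sqrt hsq
      _ = Real.sqrt A * Real.sqrt e := Real.sqrt_mul hA e

end TrajectoryPowerBudget

end Summit.AnomalousDissipation.AnomalousDissipation.Theorems.DenseLoudDesignerForces.Ergodic

end
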